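import Mathlib
import HarnessLib
import Summits.NavierStokesRegularity.NavierStokesRegularity.Theorems.LocalSineTubeDoorMostTimesGenericDoor
import Summits.NavierStokesRegularity.NavierStokesRegularity.Theorems.LocalLambTubeDoorTarget
import Summits.NavierStokesRegularity.NavierStokesRegularity.Theorems.LocalSineTubeDoorStretchingDoor
import Summits.NavierStokesRegularity.NavierStokesRegularity.Theorems.LocalSineTubeDoorEnstrophyProductionDoor
import Summits.NavierStokesRegularity.NavierStokesRegularity.Theorems.LocalVelCompTubeDoorVelCompWindowRigidity

/-!
# The one-window door family — MOST-TIMES versions of the all-slices doors (Lamb, vortex stretching, enstrophy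
# production, one velocity component): fading outside an exceptional time set of density `→ 0` at `T` suffices

Cell ns-regularity-ideate, seat p6 (route-directed support for nsreg-p1's door family; anchor
`--supports stmt-NavierStokesRegularity-20017`; rungs N0-LocalTubeDoorSine / -VelComp neighbourhood).  Instances of the
most-times template `…MostTimesGenericDoor.mostTimesGenericDoor_of_profileWindowRigidity` with the PROVED all-slices profile
cruxes of this seat's doors and of route `LocalVelCompTubeDoor` (S10, CLOSED·proved items).  In each: classical Leray–Hopf
on `[0,T)` from rapidly decaying data, LOCALLY Type I at `(x₀,T)`, `U` nonempty open, an exceptional time set `E` with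
`|E ∩ (T−h,T)| ≤ εh` for all small `h` (every `ε > 0`), and the scale-normalised window scalar fading in `L¹(U)` along
EVERY sequence `tₖ → T` in `[0,T) ∖ E` ⇒ `IsBackwardBoundedAt u T x₀`:

* `mostTimesLambDoor` — scalar `(T−t)^{3/2} ‖u × curl u‖` (crux `beltramiWindowRigidity`, p455778);
* `mostTimesStretchingDoor` — scalar `(T−t)² ‖(ω·∇)u‖` (crux `stretchingProfileRigidity`, p457904);
* `mostTimesEnstrophyProductionDoor` — scalar `(T−t)³ |⟪ω, Du ω⟫|` (crux `productionWindowRigidity`, p459001/p459220);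
* `mostTimesVelCompDoor` — scalar `(T−t) ⟪u, e⟫²`, `e ≠ 0` (crux = S10's K2′ `velCompWindowRigidity`, p433644): the
  MOST-TIMES strengthening of the banked rung `…Theses.LocalVelCompTubeDoor.Target`.

WHAT THIS IS NOT: not a claim about Navier–Stokes regularity (Clay A) — LOCAL regularity CRITERIA conditional on local
Type I (bears_on LADDER-NS N0); establishment in the cell's sense needs the cross-family referee PASS + independent
reproduction.
-/

noncomputable section

-- the summit and its single sub-problem share the name (CONVENTIONS §1), as in every Theorems file
set_option linter.dupNamespace false

namespace Summit.NavierStokesRegularity.NavierStokesRegularity.Theorems.LocalSineTubeDoorMostTimesAllSlicesDoors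

open MeasureTheory Set Function Filter Topology TopologicalSpace Metric
open scoped RealInnerProductSpace InnerProductSpace NNReal ENNReal
open Literature.Analysis Literature.Analysis.FluidPDE
open Summit.NavierStokesRegularity.NavierStokesRegularity.Theorems.LocalSineTubeDoorMostTimesGenericDoor
open Summit.NavierStokesRegularity.NavierStokesRegularity.Theorems.LocalLambTubeDoorTarget
open Summit.NavierStokesRegularity.NavierStokesRegularity.Theorems.LocalLambTubeDoorBeltramiProfileRigidity
open Summit.NavierStokesRegularity.NavierStokesRegularity.Theorems.LocalSineTubeDoorStretchingDoor
open Summit.NavierStokesRegularity.NavierStokesRegularity.Theorems.LocalSineTubeDoorEnstrophyProductionDoor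
open Summit.NavierStokesRegularity.NavierStokesRegularity.Theorems.LocalSineTubeDoorEnstrophyProductionProfileRigidity
open Summit.NavierStokesRegularity.NavierStokesRegularity.Theorems.LocalVelCompTubeDoorVelCompWindowRigidity

/-- **MOST-TIMES LAMB-VECTOR DOOR** (conditional on local Type I). -/
theorem mostTimesLambDoor :
    ∀ (ν T : ℝ), 0 < ν → 0 < T → ∀ (u : ℝ → EuclideanSpace ℝ (Fin 3) → EuclideanSpace ℝ (Fin 3))
      (p : ℝ → EuclideanSpace ℝ (Fin 3) → ℝ),
    Literature.Analysis.FluidPDE.IsClassicalNSSolutionOn (Set.Ico 0 T) ν 0 u p →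
    Literature.Analysis.FluidPDE.IsLerayHopfOn T ν 0 (u 0) u →
    Literature.Analysis.FluidPDE.HasRapidSpatialDecay (u 0) →
    ∀ (x₀ : EuclideanSpace ℝ (Fin 3)) (ρ M : ℝ), 0 < ρ →
    (∀ t ∈ Set.Ico 0 T, T - ρ ^ 2 < t → ∀ x ∈ Metric.ball x₀ ρ, ‖u t x‖ * Real.sqrt (ν * (T - t)) ≤ M) →
    ∀ (U : Set (EuclideanSpace ℝ (Fin 3))), IsOpen U → U.Nonempty →
    ∀ (E : Set ℝ), (∀ ε > 0, ∀ᶠ h in nhdsWithin (0 : ℝ) (Set.Ioi 0),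
      MeasureTheory.volume (E ∩ Set.Ioo (T - h) T) ≤ ENNReal.ofReal (ε * h)) →
    (∀ t : ℕ → ℝ, (∀ k, t k ∈ Set.Ico 0 T ∧ t k ∉ E) → Filter.Tendsto t Filter.atTop (nhds T) →
      Filter.Tendsto (fun k => ∫⁻ y in U, ENNReal.ofReal
        (Real.sqrt (T - t k) ^ 3 * ‖Literature.Analysis.FluidPDE.cross (u (t k) (x₀ + Real.sqrt (T - t k) • y))
          (Literature.Analysis.FluidPDE.curl (u (t k)) (x₀ + Real.sqrt (T - t k) • y))‖)) Filter.atTop (nhds 0)) →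
    Literature.Analysis.FluidPDE.IsBackwardBoundedAt u T x₀ := by
  intro ν T hν hT u p hsol hLH hdec x₀ ρ M hρ hM U hU hUne E hE hfadeE
  refine mostTimesGenericDoor_of_profileWindowRigidity (fun x A => ‖cross x (curlCLM A)‖) continuous_lambNorm
    lambNorm_zeroSet_invariant beltramiWindowRigidity ν T hν hT u p hsol hLH hdec x₀ ρ M hρ hM U hU hUne E hE
    fun t htk htT => ?_
  refine (hfadeE t htk htT).congr fun k => ?_
  refine lintegral_congr fun y => ?_
  rw [map_smul, ← curl_eq_curlCLM, cross_smul_smul, norm_smul, Real.norm_eq_abs, abs_of_nonneg (by positivity),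
    abs_of_nonneg (by positivity)]
  ring_nf

/-- The all-slices window crux of the stretching door in window form (from the slab form + window → slab). -/
theorem stretchingWindowRigidity :
    ∀ (C : ℝ) (v : ℝ → EuclideanSpace ℝ (Fin 3) → EuclideanSpace ℝ (Fin 3)),
      Literature.Analysis.FluidPDE.HasTypeITimeDecay C v →
      ContinuousOn (Function.uncurry v) (Set.Iio (0 : ℝ) ×ˢ Set.univ) →
      (∀ s t : ℝ, s < t → t < 0 → ∀ x, v t x =
        Literature.Analysis.UnboundedOperators.heatExtension (v s) (t - s) x -
          Literature.Analysis.FluidPDE.oseenDuhamel 1 s v v t x) →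
      (∀ t < 0, Literature.Analysis.FluidPDE.VectorCalculus.IsDivFree (v t)) →
      (∀ s < 0, ∃ U : Set (EuclideanSpace ℝ (Fin 3)), IsOpen U ∧ U.Nonempty ∧
        ∀ z ∈ U, (fun (_ : EuclideanSpace ℝ (Fin 3)) (A : EuclideanSpace ℝ (Fin 3) →L[ℝ] EuclideanSpace ℝ (Fin 3)) =>
          ‖A (Literature.Analysis.FluidPDE.curlCLM A)‖) (v s z) (fderiv ℝ (v s) z) = 0) →
      ¬ Literature.Analysis.FluidPDE.IsBackwardSingularPoint v 0 :=
  fun C v hrate hcont hmild hdiv hwin =>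
    stretchingProfileRigidity C v hrate hcont hmild hdiv (stretchingWindowToSlabF C v hrate hcont hmild hdiv hwin)

/-- **MOST-TIMES VORTEX-STRETCHING DOOR** (conditional on local Type I). -/
theorem mostTimesStretchingDoor :
    ∀ (ν T : ℝ), 0 < ν → 0 < T → ∀ (u : ℝ → EuclideanSpace ℝ (Fin 3) → EuclideanSpace ℝ (Fin 3))
      (p : ℝ → EuclideanSpace ℝ (Fin 3) → ℝ),
    Literature.Analysis.FluidPDE.IsClassicalNSSolutionOn (Set.Ico 0 T) ν 0 u p →
    Literature.Analysis.FluidPDE.IsLerayHopfOn T ν 0 (u 0) u →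
    Literature.Analysis.FluidPDE.HasRapidSpatialDecay (u 0) →
    ∀ (x₀ : EuclideanSpace ℝ (Fin 3)) (ρ M : ℝ), 0 < ρ →
    (∀ t ∈ Set.Ico 0 T, T - ρ ^ 2 < t → ∀ x ∈ Metric.ball x₀ ρ, ‖u t x‖ * Real.sqrt (ν * (T - t)) ≤ M) →
    ∀ (U : Set (EuclideanSpace ℝ (Fin 3))), IsOpen U → U.Nonempty →
    ∀ (E : Set ℝ), (∀ ε > 0, ∀ᶠ h in nhdsWithin (0 : ℝ) (Set.Ioi 0),
      MeasureTheory.volume (E ∩ Set.Ioo (T - h) T) ≤ ENNReal.ofReal (ε * h)) →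
    (∀ t : ℕ → ℝ, (∀ k, t k ∈ Set.Ico 0 T ∧ t k ∉ E) → Filter.Tendsto t Filter.atTop (nhds T) →
      Filter.Tendsto (fun k => ∫⁻ y in U, ENNReal.ofReal
        ((T - t k) ^ 2 * ‖fderiv ℝ (u (t k)) (x₀ + Real.sqrt (T - t k) • y)
          (Literature.Analysis.FluidPDE.curl (u (t k)) (x₀ + Real.sqrt (T - t k) • y))‖)) Filter.atTop (nhds 0)) →
    Literature.Analysis.FluidPDE.IsBackwardBoundedAt u T x₀ := by
  intro ν T hν hT u p hsol hLH hdec x₀ ρ M hρ hM U hU hUne E hE hfadeE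
  refine mostTimesGenericDoor_of_profileWindowRigidity (fun _ A => ‖A (curlCLM A)‖) continuous_stretchNorm
    stretchNorm_zeroSet_invariant stretchingWindowRigidity ν T hν hT u p hsol hLH hdec x₀ ρ M hρ hM U hU hUne E hE
    fun t htk htT => ?_
  refine (hfadeE t htk htT).congr fun k => ?_
  refine lintegral_congr fun y => ?_
  have hs : 0 ≤ T - t k := (sub_pos.2 (htk k).1.2).le
  rw [map_smul, _root_.smul_apply, map_smul, smul_smul, ← curl_eq_curlCLM, norm_smul, Real.sq_sqrt hs,
    Real.norm_eq_abs, abs_of_nonneg (mul_nonneg hs hs), ← sq, abs_of_nonneg (mul_nonneg (sq_nonneg _) (norm_nonneg _))]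

/-- The production window crux in the template's `F`-form (window → slab + slab rigidity). -/
theorem productionWindowRigidityF :
    ∀ (C : ℝ) (v : ℝ → EuclideanSpace ℝ (Fin 3) → EuclideanSpace ℝ (Fin 3)),
      Literature.Analysis.FluidPDE.HasTypeITimeDecay C v →
      ContinuousOn (Function.uncurry v) (Set.Iio (0 : ℝ) ×ˢ Set.univ) →
      (∀ s t : ℝ, s < t → t < 0 → ∀ x, v t x =
        Literature.Analysis.UnboundedOperators.heatExtension (v s) (t - s) x -
          Literature.Analysis.FluidPDE.oseenDuhamel 1 s v v t x) →
      (∀ t < 0, Literature.Analysis.FluidPDE.VectorCalculus.IsDivFree (v t)) →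
      (∀ s < 0, ∃ U : Set (EuclideanSpace ℝ (Fin 3)), IsOpen U ∧ U.Nonempty ∧
        ∀ z ∈ U, (fun (_ : EuclideanSpace ℝ (Fin 3)) (A : EuclideanSpace ℝ (Fin 3) →L[ℝ] EuclideanSpace ℝ (Fin 3)) =>
          |⟪Literature.Analysis.FluidPDE.curlCLM A, A (Literature.Analysis.FluidPDE.curlCLM A)⟫_ℝ|)
          (v s z) (fderiv ℝ (v s) z) = 0) →
      ¬ Literature.Analysis.FluidPDE.IsBackwardSingularPoint v 0 :=
  fun C v hrate hcont hmild hdiv hwin =>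
    productionSlabRigidityF C v hrate hcont hmild hdiv (productionWindowToSlabF C v hrate hcont hmild hdiv hwin)

/-- **MOST-TIMES ENSTROPHY-PRODUCTION DOOR** (conditional on local Type I). -/
theorem mostTimesEnstrophyProductionDoor :
    ∀ (ν T : ℝ), 0 < ν → 0 < T → ∀ (u : ℝ → EuclideanSpace ℝ (Fin 3) → EuclideanSpace ℝ (Fin 3))
      (p : ℝ → EuclideanSpace ℝ (Fin 3) → ℝ),
    Literature.Analysis.FluidPDE.IsClassicalNSSolutionOn (Set.Ico 0 T) ν 0 u p →
    Literature.Analysis.FluidPDE.IsLerayHopfOn T ν 0 (u 0) u →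
    Literature.Analysis.FluidPDE.HasRapidSpatialDecay (u 0) →
    ∀ (x₀ : EuclideanSpace ℝ (Fin 3)) (ρ M : ℝ), 0 < ρ →
    (∀ t ∈ Set.Ico 0 T, T - ρ ^ 2 < t → ∀ x ∈ Metric.ball x₀ ρ, ‖u t x‖ * Real.sqrt (ν * (T - t)) ≤ M) →
    ∀ (U : Set (EuclideanSpace ℝ (Fin 3))), IsOpen U → U.Nonempty →
    ∀ (E : Set ℝ), (∀ ε > 0, ∀ᶠ h in nhdsWithin (0 : ℝ) (Set.Ioi 0),
      MeasureTheory.volume (E ∩ Set.Ioo (T - h) T) ≤ ENNReal.ofReal (ε * h)) →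
    (∀ t : ℕ → ℝ, (∀ k, t k ∈ Set.Ico 0 T ∧ t k ∉ E) → Filter.Tendsto t Filter.atTop (nhds T) →
      Filter.Tendsto (fun k => ∫⁻ y in U, ENNReal.ofReal
        ((T - t k) ^ 3 * |⟪Literature.Analysis.FluidPDE.curl (u (t k)) (x₀ + Real.sqrt (T - t k) • y),
          fderiv ℝ (u (t k)) (x₀ + Real.sqrt (T - t k) • y)
            (Literature.Analysis.FluidPDE.curl (u (t k)) (x₀ + Real.sqrt (T - t k) • y))⟫_ℝ|)) Filter.atTop (nhds 0)) →
    Literature.Analysis.FluidPDE.IsBackwardBoundedAt u T x₀ := by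
  intro ν T hν hT u p hsol hLH hdec x₀ ρ M hρ hM U hU hUne E hE hfadeE
  refine mostTimesGenericDoor_of_profileWindowRigidity (fun _ A => |⟪curlCLM A, A (curlCLM A)⟫_ℝ|)
    continuous_productionAbs productionAbs_zeroSet_invariant productionWindowRigidityF ν T hν hT u p hsol hLH hdec x₀
    ρ M hρ hM U hU hUne E hE fun t htk htT => ?_
  refine (hfadeE t htk htT).congr fun k => ?_
  refine lintegral_congr fun y => ?_
  have hs : 0 ≤ T - t k := (sub_pos.2 (htk k).1.2).le
  rw [map_smul, _root_.smul_apply, map_smul, ← curl_eq_curlCLM, real_inner_smul_left, real_inner_smul_right,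
    real_inner_smul_right, Real.sq_sqrt hs, abs_abs, abs_mul, abs_mul, abs_mul, abs_of_nonneg hs]
  ring

/-- `F(x, A) = ⟪x, e⟫²` is continuous. -/
theorem continuous_velCompSq (e : EuclideanSpace ℝ (Fin 3)) :
    Continuous fun q : EuclideanSpace ℝ (Fin 3) × (EuclideanSpace ℝ (Fin 3) →L[ℝ] EuclideanSpace ℝ (Fin 3)) =>
      ⟪q.1, e⟫_ℝ ^ 2 :=
  (continuous_fst.inner continuous_const).pow 2

/-- The zero set of `F(x, A) = ⟪x, e⟫²` is invariant under positive rescalings. -/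
theorem velCompSq_zeroSet_invariant (e : EuclideanSpace ℝ (Fin 3)) :
    ∀ (a b : ℝ), 0 < a → 0 < b → ∀ (x : EuclideanSpace ℝ (Fin 3))
      (A : EuclideanSpace ℝ (Fin 3) →L[ℝ] EuclideanSpace ℝ (Fin 3)), ⟪a • x, e⟫_ℝ ^ 2 = 0 ↔ ⟪x, e⟫_ℝ ^ 2 = 0 := by
  intro a b ha _ x A
  rw [real_inner_smul_left, mul_pow, mul_eq_zero, or_iff_right (pow_ne_zero 2 ha.ne')]

/-- S10's K2′ in the template's `F`-form, `F(x, A) = ⟪x, e⟫²` (from the tree theorem `velCompWindowRigidity`, p433644). -/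
theorem velCompWindowRigidityF {e : EuclideanSpace ℝ (Fin 3)} (he : e ≠ 0) :
    ∀ (C : ℝ) (v : ℝ → EuclideanSpace ℝ (Fin 3) → EuclideanSpace ℝ (Fin 3)),
      Literature.Analysis.FluidPDE.HasTypeITimeDecay C v →
      ContinuousOn (Function.uncurry v) (Set.Iio (0 : ℝ) ×ˢ Set.univ) →
      (∀ s t : ℝ, s < t → t < 0 → ∀ x, v t x =
        Literature.Analysis.UnboundedOperators.heatExtension (v s) (t - s) x -
          Literature.Analysis.FluidPDE.oseenDuhamel 1 s v v t x) →
      (∀ t < 0, Literature.Analysis.FluidPDE.VectorCalculus.IsDivFree (v t)) →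
      (∀ s < 0, ∃ U : Set (EuclideanSpace ℝ (Fin 3)), IsOpen U ∧ U.Nonempty ∧
        ∀ z ∈ U, (fun (x : EuclideanSpace ℝ (Fin 3)) (_ : EuclideanSpace ℝ (Fin 3) →L[ℝ] EuclideanSpace ℝ (Fin 3)) =>
          ⟪x, e⟫_ℝ ^ 2) (v s z) (fderiv ℝ (v s) z) = 0) →
      ¬ Literature.Analysis.FluidPDE.IsBackwardSingularPoint v 0 := by
  intro C v hrate hcont hmild hdiv hwin
  refine velCompWindowRigidity C v hrate hcont hmild hdiv e he fun s hs => ?_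
  obtain ⟨U, hU, hne, hal⟩ := hwin s hs
  exact ⟨U, hU, hne, fun y hy => by simpa [sq_eq_zero_iff] using hal y hy⟩

/-- **MOST-TIMES VELOCITY-COMPONENT DOOR** (the most-times strengthening of the banked rung
`…Theses.LocalVelCompTubeDoor.Target`; conditional on local Type I). -/
theorem mostTimesVelCompDoor :
    ∀ (ν T : ℝ), 0 < ν → 0 < T → ∀ (u : ℝ → EuclideanSpace ℝ (Fin 3) → EuclideanSpace ℝ (Fin 3))
      (p : ℝ → EuclideanSpace ℝ (Fin 3) → ℝ),
    Literature.Analysis.FluidPDE.IsClassicalNSSolutionOn (Set.Ico 0 T) ν 0 u p →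
    Literature.Analysis.FluidPDE.IsLerayHopfOn T ν 0 (u 0) u →
    Literature.Analysis.FluidPDE.HasRapidSpatialDecay (u 0) →
    ∀ (x₀ : EuclideanSpace ℝ (Fin 3)) (ρ M : ℝ), 0 < ρ →
    (∀ t ∈ Set.Ico 0 T, T - ρ ^ 2 < t → ∀ x ∈ Metric.ball x₀ ρ, ‖u t x‖ * Real.sqrt (ν * (T - t)) ≤ M) →
    ∀ (U : Set (EuclideanSpace ℝ (Fin 3))), IsOpen U → U.Nonempty →
    ∀ (e : EuclideanSpace ℝ (Fin 3)), e ≠ 0 →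
    ∀ (E : Set ℝ), (∀ ε > 0, ∀ᶠ h in nhdsWithin (0 : ℝ) (Set.Ioi 0),
      MeasureTheory.volume (E ∩ Set.Ioo (T - h) T) ≤ ENNReal.ofReal (ε * h)) →
    (∀ t : ℕ → ℝ, (∀ k, t k ∈ Set.Ico 0 T ∧ t k ∉ E) → Filter.Tendsto t Filter.atTop (nhds T) →
      Filter.Tendsto (fun k => ∫⁻ y in U, ENNReal.ofReal
        (⟪Real.sqrt (T - t k) • u (t k) (x₀ + Real.sqrt (T - t k) • y), e⟫_ℝ ^ 2)) Filter.atTop (nhds 0)) →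
    Literature.Analysis.FluidPDE.IsBackwardBoundedAt u T x₀ := by
  intro ν T hν hT u p hsol hLH hdec x₀ ρ M hρ hM U hU hUne e he E hE hfadeE
  refine mostTimesGenericDoor_of_profileWindowRigidity (fun x _ => ⟪x, e⟫_ℝ ^ 2) (continuous_velCompSq e)
    (velCompSq_zeroSet_invariant e) (velCompWindowRigidityF he) ν T hν hT u p hsol hLH hdec x₀ ρ M hρ hM U hU hUne E
    hE fun t htk htT => ?_
  refine (hfadeE t htk htT).congr fun k => ?_
  refine lintegral_congr fun y => ?_
  rw [abs_of_nonneg (sq_nonneg _)]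

end Summit.NavierStokesRegularity.NavierStokesRegularity.Theorems.LocalSineTubeDoorMostTimesAllSlicesDoors

end
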